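import Summits.CriticalPhenomena.PercolationContinuityZ3.Theorems.Transplant.PlanarSkeletonFrmQuasiDefs
import Summits.CriticalPhenomena.PercolationContinuityZ3.Theorems.Transplant.PlanarSkeletonFrmFromReflect
import HarnessLib

/-!
# Row c2 of the (N3-b) quasi-step rung: coordinate reflections and the transpose of the QUASI-STEP carrier `PlanarSkeletonFrmQuasi` — the twin of
# `PlanarSkeletonFrmFrom.reflect` («PlanarSkeletonFrmFromReflect», p3 g26) with (ι) ↦ (ι_M) `Skelφ.QStepsN` and (κ′) ↦ (κ″): **`PlanarSkeletonFrmQuasi.reflect s`**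
# (`φ ↦ (s₀φ₀, s₁φ₁)`) and **`PlanarSkeletonFrmQuasi.transpose`** (`φ ↦ Skelφ.trφ φ`), same types, frames, degree bound, cost `M`, width `ℓ₀`, fattening `W`;
# quasi-steps re-signed / transposed, cylinders equal as sets; API `reflect_*` / `transpose_*`, **`reflect_cylSubcritical_iff`** / **`transpose_cylSubcritical_iff`**,
# and the dictionary square `PlanarSkeletonFrmFrom.toFrmQuasi_reflect`

builds on p205010 (kernel theorem, internal audit signed; external expert review pending) — nothing in this file uses p205010.  Lane `prim-bschramm`,
seat `prim-hp-8` (gen 62, port pen); row (c2) handed BY NAME by the design owner (p3 g29, lane INBOX 2026-08-27 06:53Z: «`PlanarSkeletonFrmQuasi.reflect`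
for the sign flips / transpose, field by field — `qstep` via `QStepsN.comp`/units/trφ of «SkelPhiQStepsNMaps» p504935, `cyl_reach` by box symmetry,
`reflect_cyl`, `reflect_cylSubcritical_iff`»); WAVE-Q-MANIFEST v0.3 §3/§9 row c2 (carrier dictionary), typed against the carrier «PlanarSkeletonFrmQuasiDefs»
(p507026; R2 in the form fixed by the refuter's R2′ verdict: (ι) := `Skelφ.QStepsN G φ M`, exact start footprint).  Two definitions (`reflect`, `transpose`:
structure-valued — review-queued by D-0009), no statement, no `@[conjecture]`; NOTHING about any open node ((N3-b), the end state) claimed.  Helper file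
(`--supports stmt-CriticalPhenomena-4575 --as helper`).
Proofs = «PlanarSkeletonFrmFromReflect» :32–:100 with the carrier token changed, the fields `M`/`ℓ₀`/`W` carried, the quasi-step field re-signed by gen-1 g4's
`Skelφ.QStepsN.units_smul` / transposed by `Skelφ.QStepsN.trφ` («SkelPhiQStepsNMaps»), `lip`/`frame` of the transpose by `Skelφ.lip_trφ`/`Skelφ.frames_trφ`
(«SkelPhiOrientation»), and (κ″) transported across the equality of the cylinders (`exists_reachable_induce_of_eq`).
* §1 tools: `setOf_smul_sub_mem_box_eq`, `setOf_trφ_sub_mem_box_eq`, `exists_reachable_induce_of_eq`, **`cylSubcritical_iff_of_cyl_eq`** (Φ2 depends on the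
  types and the cylinders only);
* §2 **`reflect`** + `reflect_types/M/ℓ₀/W/Δ/φ`, `reflect_cyl`, **`reflect_cylSubcritical_iff`**, `reflect_sub`, `reflect_reflect_φ`;
* §3 **`transpose`** + `transpose_types/M/ℓ₀/W/Δ/φ`, `transpose_cyl`, **`transpose_cylSubcritical_iff`**, `transpose_transpose_φ`;
* §4 **`PlanarSkeletonFrmFrom.toFrmQuasi_reflect`**: reflecting then forgetting = forgetting then reflecting (`rfl`).
[cite: KozmaNitzan2024, §4 p. 15 (boxes and their translates)] [cite: MartineauTassion2017, §3.2] [this work]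
-/

noncomputable section

namespace Summit.CriticalPhenomena.PercolationContinuityZ3.Theorems.Transplant

open Literature.Probability.Percolation Literature.Probability.LatticeModels SimpleGraph
open scoped Classical

namespace PlanarSkeletonFrmQuasi

variable {V : Type} {G : SimpleGraph V} [G.LocallyFinite]

/-! ## §1 Tools: sign flips and the transpose preserve cylinders; Φ2 depends on the types and the cylinders only -/

/-- Sign-changing the coordinates of a chart does not change its cylinders (as sets). [folklore] -/
theorem setOf_smul_sub_mem_box_eq (φ : V → Site 2) (s : Fin 2 → ℤˣ) (t : V) (ℓ : ℕ) :
    {w : V | ((fun i => (s i : ℤ) * φ w i) - fun i => (s i : ℤ) * φ t i) ∈ box 2 ℓ} = {w : V | φ w - φ t ∈ box 2 ℓ} := by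
  ext w
  simp only [Set.mem_setOf_eq]
  have e : ((fun i => (s i : ℤ) * φ w i) - fun i => (s i : ℤ) * φ t i) = fun i => (s i : ℤ) * (φ w - φ t) i := by
    ext i; simp only [Pi.sub_apply]; ring
  rw [e, PlanarSkeletonFrm.smul_mem_box_iff]

/-- Transposing the coordinates of a chart does not change its cylinders (as sets). [folklore] -/
theorem setOf_trφ_sub_mem_box_eq (φ : V → Site 2) (t : V) (ℓ : ℕ) :
    {w : V | Skelφ.trφ φ w - Skelφ.trφ φ t ∈ box 2 ℓ} = {w : V | φ w - φ t ∈ box 2 ℓ} := by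
  ext w; exact Skelφ.sub_mem_box_trφ φ t w ℓ

omit [G.LocallyFinite] in
/-- Reachability inside an induced subgraph, transported across an equality of the inducing sets. [folklore] -/
theorem exists_reachable_induce_of_eq {S S' : Set V} (e : S = S') {u v : V} (hu : u ∈ S) (hv : v ∈ S)
    (h : (G.induce S).Reachable ⟨u, hu⟩ ⟨v, hv⟩) :
    ∃ (hu' : u ∈ S') (hv' : v ∈ S'), (G.induce S').Reachable ⟨u, hu'⟩ ⟨v, hv'⟩ := by
  subst e
  exact ⟨hu, hv, h⟩

/-- **Φ2 (`CylSubcritical`) depends on the types and the cylinders only**: two quasi-step skeletons on the same graph with the same base vertices and the same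
cylinders (as sets) have the same `CylSubcritical p`. [folklore] -/
theorem cylSubcritical_iff_of_cyl_eq (Ψ Φ : PlanarSkeletonFrmQuasi G) (htypes : Ψ.types = Φ.types) (hcyl : ∀ t ℓ, Ψ.cyl t ℓ = Φ.cyl t ℓ)
    (p : unitInterval) : Ψ.CylSubcritical p ↔ Φ.CylSubcritical p := by
  unfold CylSubcritical
  rw [htypes]
  refine forall₂_congr fun t _ => forall_congr' fun ℓ => ?_
  have key : ∀ (S S' : Set V) (_ : S = S') (hm : t ∈ S) (hm' : t ∈ S'),
      theta (G.induce S) ⟨t, hm⟩ p = theta (G.induce S') ⟨t, hm'⟩ p := by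
    intro S S' e hm hm'; subst e; rfl
  constructor
  · intro h; rw [← key _ _ (hcyl t ℓ)]; exact h
  · intro h; rw [key _ _ (hcyl t ℓ)]; exact h

/-! ## §2 The reflected quasi-step skeleton and its API -/

/-- **The reflected quasi-step skeleton** `φ ↦ (s₀φ₀, s₁φ₁)`: still a `PlanarSkeletonFrmQuasi` (same types, frames, degree bound, cost `M`, width `ℓ₀` and
fattening `W`; exact-footprint quasi-steps re-signed — `Skelφ.QStepsN.units_smul`; cylinders and their fattenings equal as sets). [this work] -/
def reflect (Φ : PlanarSkeletonFrmQuasi G) (s : Fin 2 → ℤˣ) : PlanarSkeletonFrmQuasi G where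
  φ := fun w i => (s i : ℤ) * Φ.φ w i
  lip := by
    intro u v huv i
    have := Φ.lip huv i
    rw [← mul_sub, Literature.Probability.Percolation.BGN.abs_units_mul]; exact this
  types := Φ.types
  frame := by
    intro v
    obtain ⟨t, ht, α, hαt, hα⟩ := Φ.frame v
    refine ⟨t, ht, α, hαt, fun w => ?_⟩
    ext i
    simp only [Pi.add_apply, Pi.sub_apply, hα w]
    ring
  Δ := Φ.Δ
  degree_le := Φ.degree_le
  M := Φ.M
  qstep := Φ.qstep.units_smul s
  ℓ₀ := Φ.ℓ₀
  W := Φ.W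
  cyl_reach := by
    intro t ht ℓ hℓ u v hu hv
    rw [← Set.mem_setOf_eq (p := fun w : V => ((fun i => (s i : ℤ) * Φ.φ w i) - fun i => (s i : ℤ) * Φ.φ t i) ∈ box 2 ℓ),
      setOf_smul_sub_mem_box_eq Φ.φ s t ℓ] at hu hv
    obtain ⟨hu', hv', hr⟩ := Φ.cyl_reach t ht ℓ hℓ u v hu hv
    exact exists_reachable_induce_of_eq (setOf_smul_sub_mem_box_eq Φ.φ s t (ℓ + Φ.W)).symm hu' hv' hr

/-- The reflected skeleton has the same base vertices. [folklore] -/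
@[simp] theorem reflect_types (Φ : PlanarSkeletonFrmQuasi G) (s : Fin 2 → ℤˣ) : (Φ.reflect s).types = Φ.types := rfl

/-- The reflected skeleton has the same quasi-step cost `M`. [folklore] -/
@[simp] theorem reflect_M (Φ : PlanarSkeletonFrmQuasi G) (s : Fin 2 → ℤˣ) : (Φ.reflect s).M = Φ.M := rfl

/-- The reflected skeleton has the same width `ℓ₀`. [folklore] -/
@[simp] theorem reflect_ℓ₀ (Φ : PlanarSkeletonFrmQuasi G) (s : Fin 2 → ℤˣ) : (Φ.reflect s).ℓ₀ = Φ.ℓ₀ := rfl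

/-- The reflected skeleton has the same fattening `W`. [folklore] -/
@[simp] theorem reflect_W (Φ : PlanarSkeletonFrmQuasi G) (s : Fin 2 → ℤˣ) : (Φ.reflect s).W = Φ.W := rfl

/-- The reflected skeleton has the same degree bound `Δ`. [folklore] -/
@[simp] theorem reflect_Δ (Φ : PlanarSkeletonFrmQuasi G) (s : Fin 2 → ℤˣ) : (Φ.reflect s).Δ = Φ.Δ := rfl

/-- The reflected chart, unfolded. [folklore] -/
@[simp] theorem reflect_φ (Φ : PlanarSkeletonFrmQuasi G) (s : Fin 2 → ℤˣ) (w : V) (i : Fin 2) : (Φ.reflect s).φ w i = (s i : ℤ) * Φ.φ w i := rfl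

/-- The reflected skeleton has the same cylinders. [folklore] -/
theorem reflect_cyl (Φ : PlanarSkeletonFrmQuasi G) (s : Fin 2 → ℤˣ) (t : V) (ℓ : ℕ) : (Φ.reflect s).cyl t ℓ = Φ.cyl t ℓ :=
  setOf_smul_sub_mem_box_eq Φ.φ s t ℓ

/-- **Φ2 (`CylSubcritical`) is invariant under coordinate reflections.** [folklore] -/
theorem reflect_cylSubcritical_iff (Φ : PlanarSkeletonFrmQuasi G) (s : Fin 2 → ℤˣ) (p : unitInterval) :
    (Φ.reflect s).CylSubcritical p ↔ Φ.CylSubcritical p :=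
  cylSubcritical_iff_of_cyl_eq (Φ.reflect s) Φ rfl (Φ.reflect_cyl s) p

/-- Relative coordinates of the reflected chart: `φˢ w − φˢ t = (sᵢ·(φ w − φ t)ᵢ)ᵢ`. [folklore] -/
theorem reflect_sub (Φ : PlanarSkeletonFrmQuasi G) (s : Fin 2 → ℤˣ) (w t : V) (i : Fin 2) :
    (Φ.reflect s).φ w i - (Φ.reflect s).φ t i = (s i : ℤ) * (Φ.φ w i - Φ.φ t i) := by
  simp only [reflect_φ]; ring

/-- Reflecting twice with the same signs returns the chart. [folklore] -/
theorem reflect_reflect_φ (Φ : PlanarSkeletonFrmQuasi G) (s : Fin 2 → ℤˣ) : ((Φ.reflect s).reflect s).φ = Φ.φ := by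
  funext w i
  simp only [reflect_φ, ← mul_assoc, Literature.Probability.Percolation.BGN.units_mul_self, one_mul]

/-! ## §3 The transposed quasi-step skeleton and its API -/

/-- **The transposed quasi-step skeleton** `φ ↦ (φ₁, φ₀)` (`Skelφ.trφ`): still a `PlanarSkeletonFrmQuasi` (same types, frames, degree bound, cost `M`, width `ℓ₀`
and fattening `W`; `Skelφ.lip_trφ`, `Skelφ.frames_trφ`, exact-footprint quasi-steps transposed — `Skelφ.QStepsN.trφ`; cylinders equal as sets). [this work] -/
def transpose (Φ : PlanarSkeletonFrmQuasi G) : PlanarSkeletonFrmQuasi G where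
  φ := Skelφ.trφ Φ.φ
  lip := Skelφ.lip_trφ Φ.lip
  types := Φ.types
  frame := Skelφ.frames_trφ Φ.frame
  Δ := Φ.Δ
  degree_le := Φ.degree_le
  M := Φ.M
  qstep := Φ.qstep.trφ
  ℓ₀ := Φ.ℓ₀
  W := Φ.W
  cyl_reach := by
    intro t ht ℓ hℓ u v hu hv
    rw [Skelφ.sub_mem_box_trφ] at hu hv
    obtain ⟨hu', hv', hr⟩ := Φ.cyl_reach t ht ℓ hℓ u v hu hv
    exact exists_reachable_induce_of_eq (setOf_trφ_sub_mem_box_eq Φ.φ t (ℓ + Φ.W)).symm hu' hv' hr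

/-- The transposed skeleton has the same base vertices. [folklore] -/
@[simp] theorem transpose_types (Φ : PlanarSkeletonFrmQuasi G) : Φ.transpose.types = Φ.types := rfl

/-- The transposed skeleton has the same quasi-step cost `M`. [folklore] -/
@[simp] theorem transpose_M (Φ : PlanarSkeletonFrmQuasi G) : Φ.transpose.M = Φ.M := rfl

/-- The transposed skeleton has the same width `ℓ₀`. [folklore] -/
@[simp] theorem transpose_ℓ₀ (Φ : PlanarSkeletonFrmQuasi G) : Φ.transpose.ℓ₀ = Φ.ℓ₀ := rfl

/-- The transposed skeleton has the same fattening `W`. [folklore] -/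
@[simp] theorem transpose_W (Φ : PlanarSkeletonFrmQuasi G) : Φ.transpose.W = Φ.W := rfl

/-- The transposed skeleton has the same degree bound `Δ`. [folklore] -/
@[simp] theorem transpose_Δ (Φ : PlanarSkeletonFrmQuasi G) : Φ.transpose.Δ = Φ.Δ := rfl

/-- The transposed chart is `Skelφ.trφ` of the chart. [folklore] -/
@[simp] theorem transpose_φ (Φ : PlanarSkeletonFrmQuasi G) : Φ.transpose.φ = Skelφ.trφ Φ.φ := rfl

/-- The transposed chart, unfolded: coordinate `i` reads coordinate `i.rev`. [folklore] -/
theorem transpose_φ_apply (Φ : PlanarSkeletonFrmQuasi G) (w : V) (i : Fin 2) : Φ.transpose.φ w i = Φ.φ w i.rev := rfl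

/-- The transposed skeleton has the same cylinders. [folklore] -/
theorem transpose_cyl (Φ : PlanarSkeletonFrmQuasi G) (t : V) (ℓ : ℕ) : Φ.transpose.cyl t ℓ = Φ.cyl t ℓ :=
  setOf_trφ_sub_mem_box_eq Φ.φ t ℓ

/-- **Φ2 (`CylSubcritical`) is invariant under the transpose.** [folklore] -/
theorem transpose_cylSubcritical_iff (Φ : PlanarSkeletonFrmQuasi G) (p : unitInterval) : Φ.transpose.CylSubcritical p ↔ Φ.CylSubcritical p :=
  cylSubcritical_iff_of_cyl_eq Φ.transpose Φ rfl Φ.transpose_cyl p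

/-- Transposing twice returns the chart. [folklore] -/
theorem transpose_transpose_φ (Φ : PlanarSkeletonFrmQuasi G) : Φ.transpose.transpose.φ = Φ.φ := by
  funext w i
  simp only [transpose_φ, Skelφ.trφ_apply, Fin.rev_rev]

end PlanarSkeletonFrmQuasi

/-! ## §4 The dictionary square: `toFrmQuasi` commutes with `reflect` -/

namespace PlanarSkeletonFrmFrom

variable {V : Type} {G : SimpleGraph V} [G.LocallyFinite]

/-- **Reflecting then forgetting = forgetting then reflecting**: `(Φ.reflect s).toFrmQuasi = Φ.toFrmQuasi.reflect s` (all data fields agree definitionally).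
[folklore] -/
theorem toFrmQuasi_reflect (Φ : PlanarSkeletonFrmFrom G) (s : Fin 2 → ℤˣ) : (Φ.reflect s).toFrmQuasi = Φ.toFrmQuasi.reflect s := rfl

end PlanarSkeletonFrmFrom

end Summit.CriticalPhenomena.PercolationContinuityZ3.Theorems.Transplant

end
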